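import Mathlib
import Summits.ResolutionOfSingularities.ResolutionOfSingularities.Theorems.WeightedInvariantLocalWeightedDropNCResCurveGraphStep
import Summits.ResolutionOfSingularities.ResolutionOfSingularities.Theorems.WeightedInvariantLocalWeightedDropNCResCurveGraphChart

/-!
# `WeightedInvariant.LocalWeightedDrop`: NC-RESOLUTION SETTINGS for the TOT₂ line (S-SET), part 17 — GRAPH CURVES: THE LOOP.
# From a permissible graph curve at apex dimension ≤ 1 the mover forces a head drop (finitely many identity point moves, then the curve move)

Crux item stmt-ResolutionOfSingularities-8899 `LocalWeightedDrop` (route `ResolutionOfSingularities/WeightedInvariant`), ENGINE skeleton v32,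
residual `stub_spaceNCRankDrop`; TOT2-LINE (res-L1-w43-lead-1) inner dispatch, sub-regime S-E1-CURVE (gap note `L/res-L1-w43-stub-1/E1-CURVE-GAP.md`).
[OURS · L1 W4.3 · chain w43 · seat res-L1-w43-stub-1 gen 6; def-free on parts 14–16 and res-type-056's chart step (`…NCResCurveGraphChart`);
nothing here is a statement of any manuscript; AI-produced, gate-checked, weaker than expert review.]

* `DWinsTo.of_move` — one move all of whose answers carry winning states is winning (`of_measure` + `bind`).
* **`dWinsTo_headDrop_of_graphCurve`** — THE LOOP (strong induction on the contact potential `contactSq E i φ`): terminal ⇒ the curve move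
  (part 15); otherwise the identity point move: every answer at which the head does not drop is the tangent answer (part 16), its successor is again
  a permissible graph-curve state at apex dimension ≤ 1 (parts 14/16 + the chart step) with strictly smaller potential.
-/

set_option linter.dupNamespace false -- mandated namespace of this single-conjunct summit

noncomputable section

namespace Summit.ResolutionOfSingularities.ResolutionOfSingularities.Theorems

namespace TameFourTupleDrop

namespace GraphCurve

open MvPowerSeries Literature.AlgebraicGeometry.Resolution

variable {k : Type} [Field k] {m : ℕ}

-- BODY-START
/-! ## One move whose answers carry winning states -/

/-- **ONE MOVE WHOSE EVERY ANSWER CARRIES A WINNING STATE IS WINNING.** -/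
theorem _root_.Summit.ResolutionOfSingularities.ResolutionOfSingularities.Theorems.TameFourTupleDrop.DWinsTo.of_move {St : Type}
    {germ : St → MvPowerSeries (Fin (m + 1)) k} {Q : St → Prop} {σ : St}
    (h : ∃ (Φ : Fin (m + 1) → MvPowerSeries (Fin (m + 1)) k) (w : Fin (m + 1) → ℕ),
      IsCountMove Φ w ∧ MoveClause (germ σ) Φ w (fun b' => ∃ τ', germ τ' = b' ∧ DWinsTo germ Q τ')) :
    DWinsTo germ Q σ := by
  have h1 : DWinsTo germ (fun τ => DWinsTo germ Q τ) σ := by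
    refine DWinsTo.of_measure (germ := germ) ({σ} : Set St) (fun _ => 0) ?_ (Set.mem_singleton σ)
    intro τ hτ _
    rw [Set.mem_singleton_iff] at hτ
    subst hτ
    obtain ⟨Φ, w, hmv, hcl⟩ := h
    exact ⟨Φ, w, hmv, hcl.mono fun b' ⟨τ', hb', hτ'⟩ => ⟨τ', hb', Or.inl hτ'⟩⟩
  exact h1.bind fun τ hτ => hτ

/-! ## The successor state at the tangent answer -/

/-- The successor graph datum has zero constant terms (tangent answer). -/
theorem constantCoeff_step {i : Fin (m + 1)} {φ : Fin (m + 1) → PowerSeries k} {c' : Fin (m + 1) → k}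
    (hc' : c' = c' i • tangent i φ) (j : Fin (m + 1)) (hj : j ≠ 0) :
    PowerSeries.constantCoeff (step i φ c' j) = 0 := by
  obtain ⟨p, rfl⟩ := Fin.exists_succ_eq.mpr hj
  rw [step_succ]
  exact constantCoeff_stepSeries (answer_apply_of_eq_smul_tangent hc' _ (Fin.succAbove_ne i p))


/-- **THE SUCCESSOR'S PRODUCT IS PERMISSIBLE FOR THE SUCCESSOR GRAPH CURVE** (tangent answer, same head): with `δ′ = δ.transform X 1 c′ i`,
`Φ_{C′}^* (f′·∏_{O′} x_l) ∈ (y_j : j ≠ 0)^{c}` — the chart step (res-type-056) transports `Φ_C^* g ∈ (x_j : j ≠ i)^c` to the restricted chart image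
`s^c · U · (f′·∏_{O′} x_l)` of `g`, and powers of the exceptional letter / units are immaterial. -/
theorem inOffIdeal_transform {b : MvPowerSeries (Fin (m + 1)) k} {δ : Decoration k m} {i : Fin (m + 1)} {φ : Fin (m + 1) → PowerSeries k}
    {c' : Fin (m + 1) → k} (hadm : Admissible b δ) (hφ : ∀ j, j ≠ i → PowerSeries.constantCoeff (φ j) = 0)
    (hperm : InOffIdeal i δ.c (subst (shear i φ) (δ.f * ∏ l ∈ δ.O, X l)))
    (hc' : c' = c' i • tangent i φ) (hci : c' i ≠ 0)
    (hhead : (δ.transform (fun j => (X j : MvPowerSeries (Fin (m + 1)) k)) (fun _ => 1) c' i).head = δ.head) :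
    InOffIdeal 0 (δ.transform (fun j => (X j : MvPowerSeries (Fin (m + 1)) k)) (fun _ => 1) c' i).c
      (subst (shear 0 (step i φ c'))
        ((δ.transform (fun j => (X j : MvPowerSeries (Fin (m + 1)) k)) (fun _ => 1) c' i).f *
          ∏ l ∈ (δ.transform (fun j => (X j : MvPowerSeries (Fin (m + 1)) k)) (fun _ => 1) c' i).O, X l)) := by
  classical
  set δ' := δ.transform (fun j => (X j : MvPowerSeries (Fin (m + 1)) k)) (fun _ => 1) c' i with hδ'
  have hf : δ.f ≠ 0 := hadm.2.1.ne_zero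
  have hpermX := isBPermissible_point_X δ
  have hconv : ∀ l, (fun _ : Fin (m + 1) => (1 : ℕ)) l = 0 → c' l = 0 := fun _ h => absurd h one_ne_zero
  have hXg : subst (fun j => (X j : MvPowerSeries (Fin (m + 1)) k)) (δ.f * ∏ l ∈ δ.O, X l) = δ.f * ∏ l ∈ δ.O, X l :=
    congrFun subst_self _
  -- the product through the chart: `g(chart) = s^c · H`, `H|_{y_i=0} = U · (strict · ∏ new old letters) = U · g′`
  obtain ⟨H, U, hfacH, hH, hU, hsl⟩ := Decoration.totalO_chart_eq hpermX hconv hf hci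
  rw [hXg] at hfacH
  have ho : δ'.o = δ.o := o_transform_eq_of_head_eq hhead
  have hc : δ'.c = δ.c := c_transform_eq_of_head_eq hhead
  have hfstrict : δ'.f = δ.strict (fun j => (X j : MvPowerSeries (Fin (m + 1)) k)) (fun _ => 1) c' i :=
    Decoration.transform_f_eq_strict_of_o_transform_eq hpermX hconv hf hci ho
  have hO : δ'.O = Decoration.newLetters δ.O (fun j => (X j : MvPowerSeries (Fin (m + 1)) k)) c' i := O_transform_eq_of_head_eq hhead
  have hg' : TupleGame.slice i H = U * (δ'.f * ∏ l ∈ δ'.O, X l) := by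
    rw [hsl, hfstrict, hO, Decoration.prod_X_newLetters hpermX c' hci δ.O_subset]
  -- the restricted chart image of `g` is `s^c · H|_{y_i = 0}`
  have hrestr := SliceChart.subst_restrictedChart (fun _ : Fin (m + 1) => 1) c' hconv (δ.f * ∏ l ∈ δ.O, X l) δ.c H hfacH i
  have hρ : (fun l : Fin (m + 1) => X 0 ^ ((fun _ : Fin (m + 1) => (1 : ℕ)) l) * (C (c' l) +
      if l = i then (0 : MvPowerSeries (Fin (m + 1)) k) else X (Fin.predAbove i l.succ))) =
      fun l : Fin (m + 1) => X 0 * (C (c' l) + if l = i then (0 : MvPowerSeries (Fin (m + 1)) k) else X (Fin.predAbove i l.succ)) := by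
    funext l; rw [pow_one]
  rw [hρ] at hrestr
  have hslice_eq : subst (fun j : Fin (m + 1 + 1) => if j = i.succ then (0 : MvPowerSeries (Fin (m + 1)) k) else X (Fin.predAbove i j)) H =
      TupleGame.slice i H := rfl
  rw [hslice_eq, hg'] at hrestr
  -- the chart step (res-type-056): permissibility of the successor graph for the restricted chart image
  have hstep := inOffIdeal_chart_step hperm hφ (fun j hj => answer_apply_of_eq_smul_tangent hc' j hj)
  rw [hrestr] at hstep
  -- strip `s^c` and the unit
  have hsh0 : ∀ j, j ≠ (0 : Fin (m + 1)) → PowerSeries.constantCoeff (step i φ c' j) = 0 := constantCoeff_step hc'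
  have hss := hasSubst_shear hsh0
  rw [← coe_substAlgHom hss, map_mul, map_mul, map_pow, coe_substAlgHom, subst_X hss, shear_self] at hstep
  have hU' : constantCoeff (subst (shear 0 (step i φ c')) U) ≠ 0 := by
    rw [TOT2E1.constantCoeff_subst_of_constantCoeff_zero _ (constantCoeff_shear hsh0)]; exact hU
  have h1 := InOffIdeal.of_X_pow_mul_self (i := (0 : Fin (m + 1))) hstep
  have h2 := h1.mul_left (subst (shear 0 (step i φ c')) U)⁻¹
  rw [← mul_assoc, MvPowerSeries.inv_mul_cancel _ hU', one_mul] at h2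
  rw [hc]
  exact h2

/-! ## The loop -/

/-- **FROM A PERMISSIBLE GRAPH CURVE AT APEX DIMENSION ≤ 1 THE MOVER FORCES A HEAD DROP** (OURS · L1 W4.3; S-E1-CURVE — the sub-regime
«`e(g) ≤ 1`, the point lies ON a permissible smooth curve», complementary to res-type-056's `TOT2E1.dWinsTo_headDrop_of_isolated`).  Strategy:
while some boundary letter other than the graph letter does not contain the curve, play the identity point move — every answer drops the head except
the tangent answer, whose successor is again such a state with strictly smaller contact potential `Σ (ord φ_l)²` — and at potential `0` play the
curve move `(Φ_C, 𝟙_{j ≠ i})`, which is then B-permissible and has no near point.  `m ≥ 1`, `k` infinite. -/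
theorem dWinsTo_headDrop_of_graphCurve [Infinite k] (hm : 0 < m) {b : MvPowerSeries (Fin (m + 1)) k} {δ : Decoration k m}
    (hadm : Admissible b δ) {i : Fin (m + 1)} {φ : Fin (m + 1) → PowerSeries k}
    (hφ : ∀ j, j ≠ i → PowerSeries.constantCoeff (φ j) = 0)
    (hperm : InOffIdeal i δ.c (subst (shear i φ) (δ.f * ∏ l ∈ δ.O, X l)))
    (hcol : ∀ u₁ u₂ : Fin (m + 1) → k,
      (∀ v, CobordantChart.initEval (fun _ : Fin (m + 1) => 1) (v + u₁) δ.c (δ.f * ∏ l ∈ δ.O, X l) =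
        CobordantChart.initEval (fun _ : Fin (m + 1) => 1) v δ.c (δ.f * ∏ l ∈ δ.O, X l)) →
      (∀ v, CobordantChart.initEval (fun _ : Fin (m + 1) => 1) (v + u₂) δ.c (δ.f * ∏ l ∈ δ.O, X l) =
        CobordantChart.initEval (fun _ : Fin (m + 1) => 1) v δ.c (δ.f * ∏ l ∈ δ.O, X l)) →
      ∃ α β : k, (α ≠ 0 ∨ β ≠ 0) ∧ α • u₁ + β • u₂ = 0) :
    DWinsTo (St := MvPowerSeries (Fin (m + 1)) k × Decoration k m) Prod.fst
      (fun τ => Admissible τ.1 τ.2 ∧ τ.2.head < δ.head) (b, δ) := by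
  classical
  -- strong induction on the contact potential
  suffices H : ∀ (n : ℕ) (b : MvPowerSeries (Fin (m + 1)) k) (δ : Decoration k m) (i : Fin (m + 1)) (φ : Fin (m + 1) → PowerSeries k),
      Admissible b δ → (∀ j, j ≠ i → PowerSeries.constantCoeff (φ j) = 0) →
      InOffIdeal i δ.c (subst (shear i φ) (δ.f * ∏ l ∈ δ.O, X l)) →
      (∀ u₁ u₂ : Fin (m + 1) → k,
        (∀ v, CobordantChart.initEval (fun _ : Fin (m + 1) => 1) (v + u₁) δ.c (δ.f * ∏ l ∈ δ.O, X l) =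
          CobordantChart.initEval (fun _ : Fin (m + 1) => 1) v δ.c (δ.f * ∏ l ∈ δ.O, X l)) →
        (∀ v, CobordantChart.initEval (fun _ : Fin (m + 1) => 1) (v + u₂) δ.c (δ.f * ∏ l ∈ δ.O, X l) =
          CobordantChart.initEval (fun _ : Fin (m + 1) => 1) v δ.c (δ.f * ∏ l ∈ δ.O, X l)) →
        ∃ α β : k, (α ≠ 0 ∨ β ≠ 0) ∧ α • u₁ + β • u₂ = 0) →
      contactSq δ.E i φ = n →
      DWinsTo (St := MvPowerSeries (Fin (m + 1)) k × Decoration k m) Prod.fst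
        (fun τ => Admissible τ.1 τ.2 ∧ τ.2.head < δ.head) (b, δ) from H _ b δ i φ hadm hφ hperm hcol rfl
  intro n
  induction n using Nat.strong_induction_on with
  | _ n ih =>
  intro b δ i φ hadm hφ hperm hcol hn
  by_cases hterm : ∀ l ∈ δ.E, l ≠ i → φ l = 0
  · -- terminal: the curve move
    exact dWinsTo_headDrop_of_graph_terminal hadm hm hφ hperm hterm hcol
  · -- the identity point move
    push Not at hterm
    have hf : δ.f ≠ 0 := hadm.2.1.ne_zero
    have hpermX := isBPermissible_point_X δ
    have hconv : ∀ (c : Fin (m + 1) → k) (l : Fin (m + 1)), (fun _ : Fin (m + 1) => (1 : ℕ)) l = 0 → c l = 0 :=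
      fun _ _ h => absurd h one_ne_zero
    refine DWinsTo.of_move ⟨fun j => (X j : MvPowerSeries (Fin (m + 1)) k), fun _ => 1, hpermX.1, ?_⟩
    intro c hc hc0 A G hfac hG
    -- choose the slot: `i` if live, else any live slot
    have hslot : ∃ s : Fin (m + 1), c s ≠ 0 ∧ (c i ≠ 0 → s = i) := by
      by_cases hci : c i ≠ 0
      · exact ⟨i, hci, fun _ => rfl⟩
      · obtain ⟨s, hs⟩ : ∃ s, c s ≠ 0 := Function.ne_iff.mp hc0
        exact ⟨s, hs, fun h => absurd h hci⟩
    obtain ⟨s, hcs, hsi⟩ := hslot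
    set δ' := δ.transform (fun j => (X j : MvPowerSeries (Fin (m + 1)) k)) (fun _ => 1) c s with hδ'
    have hadm' : Admissible (X 0 * TupleGame.slice s G) δ' := admissible_transform hadm hpermX (hconv c) hfac hG hcs
    refine ⟨s, hcs, ((X 0 * TupleGame.slice s G, δ') : MvPowerSeries (Fin (m + 1)) k × Decoration k m), rfl, ?_⟩
    by_cases hlt : δ'.head < δ.head
    · exact DWinsTo.of_target ⟨hadm', hlt⟩
    · -- same head: the tangent answer at the graph letter's slot
      have hhead : δ'.head = δ.head := le_antisymm (Decoration.head_transform_le hpermX (hconv c) hf hcs) (not_lt.mp hlt)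
      -- the product through the chart, for the near analysis
      obtain ⟨H, U, hfacH, hH, -, -⟩ := Decoration.totalO_chart_eq hpermX (hconv c) hf hcs
      rw [show subst (fun j => (X j : MvPowerSeries (Fin (m + 1)) k)) (δ.f * ∏ l ∈ δ.O, X l) = δ.f * ∏ l ∈ δ.O, X l from
        congrFun subst_self _] at hfacH
      obtain ⟨hc', hci⟩ := tangent_answer_of_head_eq hadm hφ hperm hcol hcs hfacH hH hhead
      have hs : s = i := hsi hci
      subst hs
      -- the successor state
      have hφ' : ∀ j, j ≠ (0 : Fin (m + 1)) → PowerSeries.constantCoeff (step s φ c j) = 0 := constantCoeff_step hc'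
      have hperm' := inOffIdeal_transform hadm hφ hperm hc' hci hhead
      have hcol' := apexLine_transform_of_head_eq hadm hcol hcs hhead hadm'
      have hE' : δ'.E = insert 0 (Decoration.newLetters δ.E (fun j => (X j : MvPowerSeries (Fin (m + 1)) k)) c s) :=
        Decoration.transform_E _ _ _ _ _
      have hlt' : contactSq δ'.E 0 (step s φ c) < n := by
        rw [hE', ← hn]
        exact contactSq_step_lt hφ hc' hci hterm
      have hwin := ih _ hlt' (X 0 * TupleGame.slice s G) δ' 0 (step s φ c) hadm' hφ' hperm' hcol' rfl
      rw [hhead] at hwin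
      exact hwin
-- BODY-END

end GraphCurve

end TameFourTupleDrop

end Summit.ResolutionOfSingularities.ResolutionOfSingularities.Theorems

end
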